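import Literature.MathematicalPhysics.QuantumFieldTheory.Balaban1983to89.B9Cor35GCubeAvgPiece

/-!
# `Balaban1983to89.B9Cor35GAtCubeLetters` — [B9] COROLLARY 3.5 p. 407 ∕ THEOREM 3.4's `G`-CLAUSE FOR THE BOND-SECTOR CUBE LETTER `G_□ = Δ_{a,□}⁻¹` OF SECT. C p. 409,
# THE ASSEMBLY: (3.85) in [4]'s majorant calculus with the first-order part of `V₃` SUMMED OVER THE BOND DIRECTIONS (r06's `ineq385_op` per direction), the (3.84)
# remainder at r05's cube letters SPLIT BY LETTER (`V = [Δ(1) − Δ(U′)] + [D₁R_□(1)D₁* − D′R_□(U′)D′*] + [Q*_□(1)aQ_□(1) − Q*_□(U′)aQ_□(U′)]`), and ★★★ `cor35_G_cube_of_pieces`: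
# `IsUnit Δ_{a,□}(U′)` + the (3.86) resolvent identities + the transfer of every left (3.42)-entry, FROM the `U = 1` entries (G-F4), the averaging piece (G-F5c's shape) and
# TWO DISPLAYED piece majorants — the Laplacian piece (3.69)–(3.73) and the projection piece (3.74)–(3.77) (sub-row G-B9-LETTERS, module M5.1b-G, FILE G-F5)

T. Bałaban, *Propagators for lattice gauge theories in a background field*, Commun. Math. Phys. **99** (1985) 389–434
[`Balaban1985BackgroundPropagators`, "B9"]; [4] = T. Bałaban, *Propagators and renormalization transformations for lattice gauge theories. II*,
Commun. Math. Phys. **96** (1984) 223–250 [`Balaban1984PropagatorsII`].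

statement-level skeleton of published theorems with citation tags; proofs where landed; nothing here is a claim about the
Yang–Mills mass gap

THE PRINTED LOCUS (verbatim, held `paper:balaban1985-cmp99-background-propagators`, journal page = PDF page + 388; page owner r06).  p. 407: *«Combining the expansions
(3.71), (3.76) and (3.80) we get Δ_a(U′U) = D\*_{U′U}D_{U′U} + Δ′(U′U) + D_{U′U}R(U′U)D\*_{U′U} + Q\*(U′U)aQ(U′U) = Δ_a(U) − V₃(A) − P₁(A) − P₂(A). (3.82)  The operator
V₃(A) is a local differential operator of the first order satisfying the bound (3.73). The operator P₁(A) was defined in (3.76). It is a non-local bounded operator and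
satisfies the bound (3.77). The operator P₂(A) … satisfies the bound … (3.83) … Δ_a(U′U) = Δ_a(U) − V(A) = (I − V(A)G(U))Δ_a(U). (3.84)  Using the bounds (3.73),
(3.77), (3.83) and assuming that Theorem 3.3 holds for G(U), we get |(V(A)G(U)J)(b)| ≦ O(1)α₁e^{−(1/2)δ₀d(y,y′)}|J| … (3.85) … G(U′U) = G(U)(I − V(A)G(U))⁻¹ = Σ_{n=0}^∞
G(U)(V(A)G(U))ⁿ, (3.86)»*; (3.73) p. 405 *«|(V₁(A)A′)(b)| ≦ … ≦ O(1)α₁((Lʲη)⁻¹|∇_UA′| + (Lʲη)⁻²|A′|), b ∈ Ω_j»*; (3.77) p. 406; Cor. 3.5 p. 407 l. 26–31; Thm 3.4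
p. 400; Thm 3.3 p. 399; (3.26)–(3.27) p. 395; p. 409 l. 1–5.  [4] Lemma 2.1 p. 234, (2.51)–(2.55) p. 232, (2.66) p. 234; p. 398 remark (scale transfer).

WHY THIS FILE (cell `lit-balaban`, sub-row G-B9-LETTERS; module M5.1b-G, FILE G-F5 = the assembly; after G-F4 `B9Cor35GCubeInputsAtOne` p643492 ✓ and G-F5c `B9Cor35GCubeAvgPiece`
p644566 ✓).  G-F4's `gStep_cube` takes ONE analytic input, the (3.85)-majorant `h385` of `V·G_□(1)` for `V = Δ_{a,□}(1) − Δ_{a,□}(U′)` realified; r06's letter-free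
`B9Ineq385VG.ineq385_op` produces such a majorant from piece majorants, but with the first-order part of `V₃` as ONE word `V¹·∇` — at def-Y's letters the Laplacian piece
expands direction by direction, `V⁰ + Σ_ν V¹_ν∇_ν`, against the per-direction (3.42)₂-entries `∇_νG_□(1)` of G-F4 (`hDG_cube ν`).  THIS FILE (§1) re-proves r06's
composition with the sum over directions (same device: `hasMajorant_comp_decay` per word, [4] (2.52)–(2.55)), (§2) splits the realified remainder `VK` of G-F4 into the three
realified pieces BY LETTER at r05's `deltaACubeY = hessY + gradY∘R_□∘divY + Q*_□a_□Q_□`, and assembles: `h385_of_pieces`, then ★★★ `cor35_G_cube_of_pieces` = `gStep_cube` fed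
with it.  After this file the bond-sector Cor. 3.5 for the cube letter rests on exactly TWO displayed piece majorants in r06's shapes over `toB6 (geoCK i □)`:
  (G-F5a) `lapPieceK b i U′ = V⁰ + Σ_ν V¹_ν·DK b i ν` with `V⁰ ≺ c_Vα₁((Lⁿη)²)⁻¹e^{−δd}`, `V¹_ν ≺ c_Vα₁(Lⁿη)⁻¹e^{−δd}` ((3.69)–(3.73) at def-Y's `hessY`);
  (G-F5b) `projPieceK b i □ parS U′ ≺ κ₁α₁((Lⁿη)²)⁻¹e^{−δd}` ((3.74)–(3.77) at r05's `gradY∘RCubeY∘divY`, from p33's∕p21's Cor. 3.5 outputs for `G′_□(U′)`, `C_□(U′)`);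
plus the averaging piece in G-F5c's shape (`hasMajorant_avgPieceK`: `κ₂ = (M₂Σ‖b_j‖)·κ_av∕α₁`, i.e. `κ₂α₁ = (M₂Σ‖b_j‖)·8(d+2)α₁(1+(d+2)α₁)b₁L^{d+1}e^{δ(2ℓ+6)}`), the `U = 1`
entries of G-F4 (`thm33_GK_cube`, rate weakened), [4] (2.61) twice and the p. 398 scale transfers for `geoCK` (p33's `exists_h261_geoCK`, `hST_geoCK`), and the located
smallness `κα₁c₁ < 1`.

WHAT THIS FILE PROVES (THEOREMS + three `def`s with bodies: the real constant `kappa385d`, the realified pieces `lapPieceK`, `projPieceK`; 0 `def … : Prop`, 0 sorry).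
* §1 (any geometry, r06's `toB6 g R H` currency) `hasMajorant_fsum` (finite sums of majorants), `kappa385d B₀ c_V κ₁ κ₂ Λ c m = B₀Λc((1 + m)c_V + κ₁ + κ₂)`, `kappa385d_nonneg`,
  ★★ `ineq385_op_dirs` — `(V⁰ + Σ_kV¹_k∇_k + P₁ + P₂)·G ≺ κ·α₁·e^{−ρd}` for `ρ + (α+β)δ₀ ≤ δ` from the (3.73)∕(3.77)∕(3.83)-shaped piece majorants at rate `δ`, `G ≺ B₀(Lⁿη)²e^{−δd}`,
  `∇_kG ≺ B₀(Lⁿη)e^{−δd}` (all `k`), (2.61) at `(δ₀, β)`, scale transfers at `(δ₀, α)` — r06's `ineq385_op` with `|κ|` first-order words.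
* §2 (r05's cube letters, def-Y's taxicab transporters `parBY`) `lapPieceK`, `projPieceK`, `conj_add'`, ★ `VK_eq_pieces` (`VK = lapPieceK + projPieceK + avgPieceK`), ★★ `h385_of_pieces`
  (the `h385` input of `gStep_cube` from: `hG`, `hDG ν`, `hLap : lapPieceK = V⁰ + Σ_νV¹_ν·DK ν` with `hV0`, `hV1 ν`, `hPr`, `hAv`, (2.61), transfers), ★★★ `cor35_G_cube_of_pieces`
  (from the same + (2.61) at `(ρ, α′)` + `κα₁c₁(dB′, ρ, α′) < 1`: `IsUnit (deltaACubeY i □ parS (parBY i) U′)` ∧ both (3.86) resolvent identities for `GVK = conj b(G_□(U′))` ∧ every left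
  entry `X·GK ≺ B₀′Pe^{−ρd}` transfers to `X·GVK U′ ≺ B₀′c₁(1 − κα₁c₁)⁻¹Pe^{−(1−α′)ρd}`).

HONEST SCOPE.  Bookkeeping over landed modules (r06's majorant calculus `B9Ineq366CPrime.hasMajorant_comp_decay` ∕ `B9Ineq385VG`, G-F4, G-F5c, r05's letters) — all BY NAME;
nothing of [B9]'s analysis is asserted.  DISPLAYED (hypotheses, not proved here): the Laplacian piece's (3.73)-form and majorants (G-F5a), the projection piece's
(3.77)-majorant (G-F5b), the averaging piece's majorant (G-F5c proves it from the level-by-level smallness of `U′`), the `U = 1` entries at the working rate (G-F4 proves them at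
`δ₃`), [4] (2.61) and the scale transfers for the cube geometry (p33's F5a under member thresholds), the smallness `κα₁c₁ < 1`, `parS 1 = 1`, `0 < b₀`.  Right (3.42)-entries,
Hölder ∕ `L²` ∕ (3.47) members NOT treated.  Count-neutral; NOT a node discharge; no summit ∕ sub-problem statement is proved; nothing continuum ∕ OS ∕ mass-gap ∕ Clay; YM
mass gap NOT proved by any of this (Track A conditional rung).  No `sorry`, no `axiom`, no `… : Prop` fact, no `instance`, no `notation`.  NEW file; nothing landed is
modified.  Cell `lit-balaban`, seat `lit-balaban-p38` gen 42, 2026-08-28; `--supports stmt-QuantumFields-19200` as helper.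
Net new unproved facts: 0.

RELATED IN THE TREE, NOT DUPLICATED: r06's `B9Ineq385VG.ineq385_op` (single first-order word; §1 is its per-direction twin, same proof device), r06's concrete-letter
`B9Thm34GUniformBlk` (not instantiable at def-Y's Hessian — G-F4's ROAD note), p33's site-sector `B9Cor35GpAtCubeLetters.cor35_Gp_cube` (the `G′_□` twin via r06's concrete
`thm34_Gp_uniform`).
-/

noncomputable section

namespace Literature.MathematicalPhysics.QuantumFieldTheory.Balaban1983to89.B9Cor35GAtCubeLetters

open Node00
open Literature.MathematicalPhysics.QuantumFieldTheory.Balaban1983to89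
open Literature.MathematicalPhysics.QuantumFieldTheory.Balaban1983to89.B6RandomWalk (HasMajorant hasMajorant_mono hasMajorant_add hasMajorant_zero Triangle254 Ineq261)
open Literature.MathematicalPhysics.QuantumFieldTheory.Balaban1983to89.B9Thm34Ext (toB6)
open Literature.MathematicalPhysics.QuantumFieldTheory.Balaban1983to89.B9Ineq347 (ScaleTransfer)
open Literature.MathematicalPhysics.QuantumFieldTheory.Balaban1983to89.B9Ineq366CPrime (hasMajorant_comp_decay hasMajorant_rate_mono)
open Literature.MathematicalPhysics.QuantumFieldTheory.Balaban1983to89.B6KLevelCensusIndexV1 (KIdx kGeo)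
open Literature.MathematicalPhysics.QuantumFieldTheory.Balaban1983to89.B6Cover236MultiLevelBlocks (cubes)
open Literature.MathematicalPhysics.QuantumFieldTheory.Balaban1983to89.B9CubeLettersOpsL0 (cubeFamY)
open Literature.MathematicalPhysics.QuantumFieldTheory.Balaban1983to89.B9CubeLettersBondOpsL0 (BlkCubeY deltaACubeY GACubeY RCubeY QCubeY QsCubeY aCubeY)
open Literature.MathematicalPhysics.QuantumFieldTheory.Balaban1983to89.B9CubeGeometryInputs (geoCK geoCK_len geoCK_len_pos geoCK_dist geoCK_dist_axioms)
open Literature.MathematicalPhysics.QuantumFieldTheory.Balaban1983to89.B9Cor35GCubeInputsAtOne (blkBK DaK GK DaVK DK GVK VK gStep_cube)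
open Literature.MathematicalPhysics.QuantumFieldTheory.Balaban1983to89.B9Cor35GCubeAvgPiece (avgPieceK kappaAv kappaAv_nonneg hasMajorant_avgPieceK)
open Literature.MathematicalPhysics.QuantumFieldTheory.Balaban1983to89.T4RelativeLadder (UnitaryLike)
open scoped Matrix

variable {d ℓ : ℕ} {hd : 1 ≤ d + 1} {hL : Odd (ℓ + 1) ∧ 1 < ℓ + 1} {b₀ b₁ : ℝ}

/-! ## §1  (3.85) in [4]'s majorant calculus with the first-order part of `V₃` summed over the bond directions: `V = V⁰ + Σ_k V¹_k∇_k + P₁ + P₂` -/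

section Abstract

variable {g : B9.Geometry} [Fintype g.Site] {R : ℝ} {H : Prop} {W : Type}

/-- a finite sum of operators with majorants has the sum of the majorants. [cite: Balaban1984PropagatorsII, (2.52) p.232, bookkeeping] -/
theorem hasMajorant_fsum {κ : Type} (blk : W → g.Site) (s : Finset κ) (T : κ → Module.End ℝ (W → ℝ)) (K : κ → g.Site → g.Site → ℝ)
    (h : ∀ k ∈ s, HasMajorant (g := toB6 g R H) blk (T k) (K k)) :
    HasMajorant (g := toB6 g R H) blk (∑ k ∈ s, T k) (fun a b => ∑ k ∈ s, K k a b) := by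
  classical
  induction s using Finset.induction_on with
  | empty => simpa using hasMajorant_zero (g := toB6 g R H) blk
  | insert k s hk ih =>
      have h' := hasMajorant_add (g := toB6 g R H) blk (h k (Finset.mem_insert_self k s)) (ih fun k' hk' => h k' (Finset.mem_insert_of_mem hk'))
      simpa [Finset.sum_insert hk] using h'

/-- **THE CONSTANT OF (3.85) WITH `m` FIRST-ORDER DIRECTIONS**: `B₀Λc·((1 + m)c_V + κ₁ + κ₂)` (r06's `kappa385` has `m = 1`).
[cite: Balaban1985BackgroundPropagators, (3.85) p.407, bookkeeping] -/
def kappa385d (B₀ cV κ₁ κ₂ Λ c : ℝ) (m : ℕ) : ℝ := B₀ * Λ * c * ((1 + (m : ℝ)) * cV + κ₁ + κ₂)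

/-- `κ ≥ 0` for non-negative constants. [cite: Balaban1985BackgroundPropagators, (3.85) p.407, bookkeeping] -/
theorem kappa385d_nonneg {B₀ cV κ₁ κ₂ Λ c : ℝ} {m : ℕ} (hB₀ : 0 ≤ B₀) (hcV : 0 ≤ cV) (hκ₁ : 0 ≤ κ₁) (hκ₂ : 0 ≤ κ₂) (hΛ : 0 ≤ Λ) (hc : 0 ≤ c) :
    0 ≤ kappa385d B₀ cV κ₁ κ₂ Λ c m := by
  unfold kappa385d; positivity

/-- ★★ **(3.85) IN THE MAJORANT CALCULUS, FIRST-ORDER PART BY DIRECTIONS** — r06's `B9Ineq385VG.ineq385_op` with `V₃ = V⁰ + Σ_{k} V¹_k·∇_k` (one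
(3.42)₂-entry `∇_kG ≺ B₀(Lʲη)e^{−δd}` per direction) instead of a single `V¹·∇`: «Using the bounds (3.73), (3.77), (3.83) and assuming that Theorem 3.3 holds for
G(U), we get |(V(A)G(U)J)(b)| ≦ O(1)α₁e^{−(1/2)δ₀d(y,y′)}|J|».  For `ρ ≧ 0`, `ρ + (α+β)δ₀ ≦ δ`: `(V⁰ + Σ_kV¹_k∇_k + P₁ + P₂)·G ≺ κ·α₁·e^{−ρd}`,
`κ = B₀Λc₁(β)((1 + |κ|)c_V + κ₁ + κ₂)`. [cite: Balaban1985BackgroundPropagators, (3.85) p.407, (3.73) p.405, (3.77) p.406, (3.83) p.407, Thm 3.3 p.399; Balaban1984PropagatorsII, Lemma 2.1 p.234, (2.52)–(2.55) p.232] -/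
theorem ineq385_op_dirs {κ : Type} [Fintype κ] (blk : W → g.Site) (d : ℕ) (δ₀ δ α β ρ Λ B₀ cV κ₁ κ₂ α₁ : ℝ)
    (hB₀ : 0 ≤ B₀) (hcV : 0 ≤ cV) (hκ₁ : 0 ≤ κ₁) (hκ₂ : 0 ≤ κ₂) (hα₁ : 0 ≤ α₁) (hΛ : 0 ≤ Λ) (hρ : 0 ≤ ρ)
    (hα : 0 ≤ α) (hβ : 0 ≤ β) (hδ₀ : 0 ≤ δ₀) (hr : ρ + (α + β) * δ₀ ≤ δ)
    (hdnn : ∀ a b : g.Site, 0 ≤ g.dist a b) (htri : Triangle254 (toB6 g R H)) (hlen : ∀ y : g.Site, 0 < g.len y)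
    (h261 : Ineq261 d (toB6 g R H) δ₀ β)
    (hT1 : ScaleTransfer g δ₀ α Λ (fun a => g.len a)) (hT2 : ScaleTransfer g δ₀ α Λ (fun a => g.len a ^ 2))
    {G V0 P₁ P₂ : Module.End ℝ (W → ℝ)} {V1 D : κ → Module.End ℝ (W → ℝ)}
    (hV0 : HasMajorant (g := toB6 g R H) blk V0 (fun a b => cV * α₁ * (g.len a ^ 2)⁻¹ * Real.exp (-(δ * g.dist a b))))
    (hV1 : ∀ k, HasMajorant (g := toB6 g R H) blk (V1 k) (fun a b => cV * α₁ * (g.len a)⁻¹ * Real.exp (-(δ * g.dist a b))))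
    (hP₁ : HasMajorant (g := toB6 g R H) blk P₁ (fun a b => κ₁ * α₁ * (g.len a ^ 2)⁻¹ * Real.exp (-(δ * g.dist a b))))
    (hP₂ : HasMajorant (g := toB6 g R H) blk P₂ (fun a b => κ₂ * α₁ * (g.len a ^ 2)⁻¹ * Real.exp (-(δ * g.dist a b))))
    (hG : HasMajorant (g := toB6 g R H) blk G (fun a b => B₀ * g.len a ^ 2 * Real.exp (-(δ * g.dist a b))))
    (hDG : ∀ k, HasMajorant (g := toB6 g R H) blk (D k * G) (fun a b => B₀ * g.len a * Real.exp (-(δ * g.dist a b)))) :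
    HasMajorant (g := toB6 g R H) blk ((V0 + ∑ k, V1 k * D k + P₁ + P₂) * G)
      (fun a b => kappa385d B₀ cV κ₁ κ₂ Λ (B6.c1 d δ₀ β) (Fintype.card κ) * α₁ * Real.exp (-(ρ * g.dist a b))) := by
  set c : ℝ := B6.c1 d δ₀ β with hc_def
  have hw1 : ∀ a : g.Site, 0 ≤ g.len a := fun a => (hlen a).le
  have hw2 : ∀ a : g.Site, 0 ≤ g.len a ^ 2 := fun a => sq_nonneg _
  have hw1i : ∀ a : g.Site, 0 ≤ (g.len a)⁻¹ := fun a => inv_nonneg.mpr (hlen a).le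
  have hw2i : ∀ a : g.Site, 0 ≤ (g.len a ^ 2)⁻¹ := fun a => inv_nonneg.mpr (sq_nonneg _)
  have hcVα : 0 ≤ cV * α₁ := mul_nonneg hcV hα₁
  have hκ₁α : 0 ≤ κ₁ * α₁ := mul_nonneg hκ₁ hα₁
  have hκ₂α : 0 ≤ κ₂ * α₁ := mul_nonneg hκ₂ hα₁
  have hρδ : ρ ≤ δ := by
    have : 0 ≤ (α + β) * δ₀ := by positivity
    linarith
  have hGρ := hasMajorant_rate_mono (R := R) (H := H) blk B₀ (fun a => g.len a ^ 2) hB₀ hw2 hρδ hdnn hG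
  have hDGρ := fun k => hasMajorant_rate_mono (R := R) (H := H) blk B₀ (fun a => g.len a) hB₀ hw1 hρδ hdnn (hDG k)
  -- the words
  have w1 := hasMajorant_comp_decay (R := R) (H := H) blk d δ₀ α β ρ δ Λ (cV * α₁) B₀ (fun a => (g.len a ^ 2)⁻¹)
    (fun a => g.len a ^ 2) hw2i hw2 hΛ hcVα hB₀ hρ hr hdnn htri hT2 h261 hV0 hGρ
  have w2 : ∀ k, HasMajorant (g := toB6 g R H) blk (V1 k * (D k * G))
      (fun a b => (cV * α₁ * B₀ * Λ * c) * ((g.len a)⁻¹ * g.len a) * Real.exp (-(ρ * g.dist a b))) := fun k =>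
    hasMajorant_comp_decay (R := R) (H := H) blk d δ₀ α β ρ δ Λ (cV * α₁) B₀ (fun a => (g.len a)⁻¹)
      (fun a => g.len a) hw1i hw1 hΛ hcVα hB₀ hρ hr hdnn htri hT1 h261 (hV1 k) (hDGρ k)
  have w3 := hasMajorant_comp_decay (R := R) (H := H) blk d δ₀ α β ρ δ Λ (κ₁ * α₁) B₀ (fun a => (g.len a ^ 2)⁻¹)
    (fun a => g.len a ^ 2) hw2i hw2 hΛ hκ₁α hB₀ hρ hr hdnn htri hT2 h261 hP₁ hGρ
  have w4 := hasMajorant_comp_decay (R := R) (H := H) blk d δ₀ α β ρ δ Λ (κ₂ * α₁) B₀ (fun a => (g.len a ^ 2)⁻¹)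
    (fun a => g.len a ^ 2) hw2i hw2 hΛ hκ₂α hB₀ hρ hr hdnn htri hT2 h261 hP₂ hGρ
  have wS := hasMajorant_fsum blk Finset.univ (fun k => V1 k * (D k * G)) _ (fun k _ => w2 k)
  have hsum := hasMajorant_add (g := toB6 g R H) blk
    (hasMajorant_add (g := toB6 g R H) blk (hasMajorant_add (g := toB6 g R H) blk w1 wS) w3) w4
  have e : (V0 + ∑ k, V1 k * D k + P₁ + P₂) * G = V0 * G + ∑ k, V1 k * (D k * G) + P₁ * G + P₂ * G := by
    rw [add_mul, add_mul, add_mul, Finset.sum_mul]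
    simp only [mul_assoc]
  rw [e]
  refine hasMajorant_mono (g := toB6 g R H) blk hsum fun a b => le_of_eq ?_
  have ha : g.len a ≠ 0 := (hlen a).ne'
  simp only [kappa385d, Finset.sum_const, Finset.card_univ, nsmul_eq_mul]
  field_simp
  ring

end Abstract

/-! ## §2  At r05's cube letters: the (3.84) remainder split by letter, the (3.85)-majorant from the three pieces, and Cor. 3.5 for `G_□` modulo the two
displayed pieces (Laplacian (3.69)–(3.73), projection (3.74)–(3.77)) -/

section Cube

variable {𝔸 : Type} [NormedRing 𝔸] [NormedAlgebra ℂ 𝔸] [CompleteSpace 𝔸]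
variable {ιb : Type} [Fintype ιb] (b : Module.Basis ιb ℝ 𝔸)
variable (i : KIdx d ℓ hd hL b₀ b₁) (q : ↥(cubes (toKT i).D.toDomains)) (parS : SiteParY 𝔸 i)

/-- **the realified LAPLACIAN PIECE `Δ(1) − Δ(U′)`** of the (3.84) remainder (def-Y's Hessian `hessY = D*𝒦D + Δ′₂`; print's `D*D + Δ′` of (3.10), expanded in
(3.69)–(3.73)). [cite: Balaban1985BackgroundPropagators, (3.69)–(3.73) pp.404–405, (3.82) p.407, (3.10) p.392] -/
def lapPieceK (V : CfgY 𝔸 i) : Module.End ℝ (FBondY i × ιb → ℝ) :=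
  B9Eq352DivFormLetters.conj b ((hessY i (fun _ _ => 1) - hessY i V).restrictScalars ℝ)

/-- **the realified PROJECTION PIECE `D₁R_□(1)D₁* − D_{U′}R_□(U′)D*_{U′}`** of the (3.84) remainder ((3.74)–(3.77): `(D′ − D)RD* + D(R′ − R)D* + D′R′(D′* − D*)`,
`R′ − R = −P₁`). [cite: Balaban1985BackgroundPropagators, (3.74)–(3.77) pp.405–406, (3.82) p.407, (3.25)–(3.26) pp.394–395] -/
def projPieceK (V : CfgY 𝔸 i) : Module.End ℝ (FBondY i × ιb → ℝ) :=
  B9Eq352DivFormLetters.conj b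
    ((gradY i (fun _ _ => 1) ∘ₗ RCubeY i q parS (fun _ _ => 1) ∘ₗ divY i (fun _ _ => 1) - gradY i V ∘ₗ RCubeY i q parS V ∘ₗ divY i V).restrictScalars ℝ)

omit [CompleteSpace 𝔸] in
/-- `conj b` is additive. [cite: Balaban1984PropagatorsII, (2.51) p.232, bookkeeping] -/
theorem conj_add' {S : Type} (T₁ T₂ : Module.End ℝ (S → 𝔸)) :
    B9Eq352DivFormLetters.conj b (T₁ + T₂) = B9Eq352DivFormLetters.conj b T₁ + B9Eq352DivFormLetters.conj b T₂ := by
  rw [← sub_neg_eq_add, B9Eq352DivFormLetters.conj_sub, B9Eq352DivFormLetters.conj_neg, sub_neg_eq_add]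

/-- ★ **(3.82)∕(3.84) SPLIT BY LETTER at r05's cube letters**: `V = Δ_{a,□}(1) − Δ_{a,□}(U′) = [Δ(1) − Δ(U′)] + [D₁R_□(1)D₁* − D′R_□(U′)D′*] + [Q*_□(1)aQ_□(1) −
Q*_□(U′)aQ_□(U′)]`, realified (def-Y's taxicab transporters for the averaging letters). [cite: Balaban1985BackgroundPropagators, (3.82)–(3.84) p.407, (3.26) p.395, p.409 l.1–5] -/
theorem VK_eq_pieces (V : CfgY 𝔸 i) :
    VK b i q parS (parBY i) V = lapPieceK b i V + projPieceK b i q parS V + avgPieceK b i q V := by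
  have e1 : (1 : CfgY 𝔸 i) = fun _ _ => 1 := rfl
  have e : deltaACubeY i q parS (parBY i) (fun _ _ => 1) - deltaACubeY i q parS (parBY i) V =
      (hessY i (fun _ _ => 1) - hessY i V) +
        (gradY i (fun _ _ => 1) ∘ₗ RCubeY i q parS (fun _ _ => 1) ∘ₗ divY i (fun _ _ => 1) - gradY i V ∘ₗ RCubeY i q parS V ∘ₗ divY i V) +
        (QsCubeY i q (parBY i) 1 ∘ₗ aCubeY i q ∘ₗ QCubeY i q (parBY i) 1 - QsCubeY i q (parBY i) V ∘ₗ aCubeY i q ∘ₗ QCubeY i q (parBY i) V) := by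
    rw [e1]; simp only [B9CubeLettersBondOpsL0.deltaACubeY]; abel
  have e2 : ((deltaACubeY i q parS (parBY i) (fun _ _ => 1) - deltaACubeY i q parS (parBY i) V).restrictScalars ℝ) =
      (hessY i (fun _ _ => 1) - hessY i V).restrictScalars ℝ +
        (gradY i (fun _ _ => 1) ∘ₗ RCubeY i q parS (fun _ _ => 1) ∘ₗ divY i (fun _ _ => 1) - gradY i V ∘ₗ RCubeY i q parS V ∘ₗ divY i V).restrictScalars ℝ +
        (QsCubeY i q (parBY i) 1 ∘ₗ aCubeY i q ∘ₗ QCubeY i q (parBY i) 1 -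
          QsCubeY i q (parBY i) V ∘ₗ aCubeY i q ∘ₗ QCubeY i q (parBY i) V).restrictScalars ℝ := by
    rw [e]; exact LinearMap.ext fun _ => rfl
  rw [VK, lapPieceK, projPieceK, avgPieceK, e2, conj_add', conj_add']

/-- ★★ **THE (3.85)-MAJORANT `h385` OF `gStep_cube` FROM THE THREE PIECES** at r05's cube letters over `toB6 (geoCK i □) Rr H`: given the `U = 1` entries `G ≺ B₀(Lⁿη)²e^{−δd}`,
`∇_νG ≺ B₀(Lⁿη)e^{−δd}` (G-F4 `thm33_GK_cube`, rate weakened to `δ`), the Laplacian piece in the form `V⁰ + Σ_νV¹_ν∇_ν` with (3.73)-shaped majorants (DISPLAYED — FILE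
G-F5a), the projection piece with a (3.77)-shaped majorant (DISPLAYED — FILE G-F5b), the averaging piece's (3.83)-majorant (G-F5c `hasMajorant_avgPieceK`, here as the
hypothesis `hAv` in its shape), [4] (2.61) at `(δ₀, β)` and the p. 398 scale transfers at `(δ₀, α)` with `ρ + (α+β)δ₀ ≤ δ`: `V·G ≺ κ·α₁·e^{−ρd}`.
[cite: Balaban1985BackgroundPropagators, (3.85) p.407, (3.73) p.405, (3.77) p.406, (3.83) p.407, Thm 3.3 p.399, p.409 l.1–5; Balaban1984PropagatorsII, Lemma 2.1 p.234] -/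
theorem h385_of_pieces (Rr : ℝ) (H : Prop) (dB : ℕ) (δ₀ δ α β ρ Λ B₀ cV κ₁ κ₂ α₁ : ℝ)
    (hB₀ : 0 ≤ B₀) (hcV : 0 ≤ cV) (hκ₁ : 0 ≤ κ₁) (hκ₂ : 0 ≤ κ₂) (hα₁ : 0 ≤ α₁) (hΛ : 0 ≤ Λ) (hρ : 0 ≤ ρ)
    (hα : 0 ≤ α) (hβ : 0 ≤ β) (hδ₀ : 0 ≤ δ₀) (hr : ρ + (α + β) * δ₀ ≤ δ)
    (h261 : Ineq261 dB (toB6 (geoCK i q) Rr H) δ₀ β)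
    (hT1 : ScaleTransfer (geoCK i q) δ₀ α Λ (fun a => (geoCK i q).len a)) (hT2 : ScaleTransfer (geoCK i q) δ₀ α Λ (fun a => (geoCK i q).len a ^ 2))
    (V : CfgY 𝔸 i)
    (hG : HasMajorant (g := toB6 (geoCK i q) Rr H) (blkBK i q) (GK b i q parS (parBY i))
      (fun a a' => B₀ * (geoCK i q).len a ^ 2 * Real.exp (-(δ * (geoCK i q).dist a a'))))
    (hDG : ∀ ν, HasMajorant (g := toB6 (geoCK i q) Rr H) (blkBK i q) (DK b i ν * GK b i q parS (parBY i))
      (fun a a' => B₀ * (geoCK i q).len a * Real.exp (-(δ * (geoCK i q).dist a a'))))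
    {V0 : Module.End ℝ (FBondY i × ιb → ℝ)} {V1 : Fin (d + 1) → Module.End ℝ (FBondY i × ιb → ℝ)}
    (hLap : lapPieceK b i V = V0 + ∑ ν, V1 ν * DK b i ν)
    (hV0 : HasMajorant (g := toB6 (geoCK i q) Rr H) (blkBK i q) V0 (fun a a' => cV * α₁ * ((geoCK i q).len a ^ 2)⁻¹ * Real.exp (-(δ * (geoCK i q).dist a a'))))
    (hV1 : ∀ ν, HasMajorant (g := toB6 (geoCK i q) Rr H) (blkBK i q) (V1 ν) (fun a a' => cV * α₁ * ((geoCK i q).len a)⁻¹ * Real.exp (-(δ * (geoCK i q).dist a a'))))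
    (hPr : HasMajorant (g := toB6 (geoCK i q) Rr H) (blkBK i q) (projPieceK b i q parS V)
      (fun a a' => κ₁ * α₁ * ((geoCK i q).len a ^ 2)⁻¹ * Real.exp (-(δ * (geoCK i q).dist a a'))))
    (hAv : HasMajorant (g := toB6 (geoCK i q) Rr H) (blkBK i q) (avgPieceK b i q V)
      (fun a a' => κ₂ * α₁ * ((geoCK i q).len a ^ 2)⁻¹ * Real.exp (-(δ * (geoCK i q).dist a a')))) :
    HasMajorant (g := toB6 (geoCK i q) Rr H) (blkBK i q) (VK b i q parS (parBY i) V * GK b i q parS (parBY i))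
      (fun a a' => kappa385d B₀ cV κ₁ κ₂ Λ (B6.c1 dB δ₀ β) (d + 1) * α₁ * Real.exp (-(ρ * (geoCK i q).dist a a'))) := by
  obtain ⟨hdnn, htri, -, -⟩ := geoCK_dist_axioms i q Rr H
  have h := ineq385_op_dirs (R := Rr) (H := H) (blkBK i q) dB δ₀ δ α β ρ Λ B₀ cV κ₁ κ₂ α₁ hB₀ hcV hκ₁ hκ₂ hα₁ hΛ hρ hα hβ hδ₀ hr hdnn htri
    (geoCK_len_pos i q) h261 hT1 hT2 hV0 hV1 hPr hAv hG hDG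
  rw [VK_eq_pieces, hLap]
  simpa [Fintype.card_fin] using h

/-- ★★★ **COROLLARY 3.5 ∕ THEOREM 3.4's `G`-CLAUSE FOR THE BOND-SECTOR CUBE LETTER `G_□ = Δ_{a,□}⁻¹`, MODULO THE LAPLACIAN AND PROJECTION PIECES** (p. 407 «The theorems hold also
for the operators (3.24), (3.25) … with U = 1»; p. 409 l. 1–5): at any background `U′` (meant `Ṽ_□ = e^{iηχ̃_□A}`, Cor. 3.6's cube road) — from the `U = 1` entries of
`G_□(1)` (G-F4), the three piece majorants of `V = Δ_{a,□}(1) − Δ_{a,□}(U′)` (Laplacian and projection DISPLAYED, averaging = G-F5c's shape), [4] Lemma 2.1 at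
`(δ₀, β)` and at `(ρ, α′)`, the scale transfers, and the located smallness `κα₁·c₁(ρ, α′) < 1` («for α₁ sufficiently small»): (i) `Δ_{a,□}(U′)` IS A UNIT (so r05's
`G_□(U′) = GACubeY … U′` is its genuine inverse — the `hunit` input of G-F2∕G-F3's `localInverse_defect_laws_chiY_parBY`); (ii) both resolvent identities of (3.86);
(iii) every left entry of `G_□(1)` at rate `ρ` transfers to `G_□(U′)`: `X·G_□(U′) ≺ B₀′c₁(1 − κα₁c₁)⁻¹P(y)e^{−(1−α′)ρd}`.
[cite: Balaban1985BackgroundPropagators, Cor. 3.5 p.407, Thm 3.4 p.400, (3.84)–(3.86) p.407, Thm 3.3 p.399, (3.42) p.397, p.409 l.1–5; Balaban1984PropagatorsII, Lemma 2.1 p.234, (2.66) p.234] -/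
theorem cor35_G_cube_of_pieces (hb₀ : 0 < b₀) (hparS : ∀ z w, parS (fun _ _ => 1) z w = 1) (Rr : ℝ) (H : Prop) (dB dB' : ℕ)
    (δ₀ δ α β ρ α' Λ B₀ cV κ₁ κ₂ α₁ : ℝ)
    (hB₀ : 0 ≤ B₀) (hcV : 0 ≤ cV) (hκ₁ : 0 ≤ κ₁) (hκ₂ : 0 ≤ κ₂) (hα₁ : 0 ≤ α₁) (hΛ : 0 ≤ Λ) (hρ : 0 ≤ ρ)
    (hα : 0 ≤ α) (hβ : 0 ≤ β) (hδ₀ : 0 ≤ δ₀) (hr : ρ + (α + β) * δ₀ ≤ δ) (hα' : α' ≤ 1) (hα'ρ : 0 ≤ (1 - α') * ρ)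
    (h261 : Ineq261 dB (toB6 (geoCK i q) Rr H) δ₀ β) (h261' : Ineq261 dB' (toB6 (geoCK i q) Rr H) ρ α')
    (hT1 : ScaleTransfer (geoCK i q) δ₀ α Λ (fun a => (geoCK i q).len a)) (hT2 : ScaleTransfer (geoCK i q) δ₀ α Λ (fun a => (geoCK i q).len a ^ 2))
    (hsmall : kappa385d B₀ cV κ₁ κ₂ Λ (B6.c1 dB δ₀ β) (d + 1) * α₁ * B6.c1 dB' ρ α' < 1)
    (V : CfgY 𝔸 i)
    (hG : HasMajorant (g := toB6 (geoCK i q) Rr H) (blkBK i q) (GK b i q parS (parBY i))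
      (fun a a' => B₀ * (geoCK i q).len a ^ 2 * Real.exp (-(δ * (geoCK i q).dist a a'))))
    (hDG : ∀ ν, HasMajorant (g := toB6 (geoCK i q) Rr H) (blkBK i q) (DK b i ν * GK b i q parS (parBY i))
      (fun a a' => B₀ * (geoCK i q).len a * Real.exp (-(δ * (geoCK i q).dist a a'))))
    {V0 : Module.End ℝ (FBondY i × ιb → ℝ)} {V1 : Fin (d + 1) → Module.End ℝ (FBondY i × ιb → ℝ)}
    (hLap : lapPieceK b i V = V0 + ∑ ν, V1 ν * DK b i ν)
    (hV0 : HasMajorant (g := toB6 (geoCK i q) Rr H) (blkBK i q) V0 (fun a a' => cV * α₁ * ((geoCK i q).len a ^ 2)⁻¹ * Real.exp (-(δ * (geoCK i q).dist a a'))))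
    (hV1 : ∀ ν, HasMajorant (g := toB6 (geoCK i q) Rr H) (blkBK i q) (V1 ν) (fun a a' => cV * α₁ * ((geoCK i q).len a)⁻¹ * Real.exp (-(δ * (geoCK i q).dist a a'))))
    (hPr : HasMajorant (g := toB6 (geoCK i q) Rr H) (blkBK i q) (projPieceK b i q parS V)
      (fun a a' => κ₁ * α₁ * ((geoCK i q).len a ^ 2)⁻¹ * Real.exp (-(δ * (geoCK i q).dist a a'))))
    (hAv : HasMajorant (g := toB6 (geoCK i q) Rr H) (blkBK i q) (avgPieceK b i q V)
      (fun a a' => κ₂ * α₁ * ((geoCK i q).len a ^ 2)⁻¹ * Real.exp (-(δ * (geoCK i q).dist a a')))) :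
    IsUnit (deltaACubeY i q parS (parBY i) V) ∧
    (GVK b i q parS (parBY i) V = GK b i q parS (parBY i) + GK b i q parS (parBY i) * VK b i q parS (parBY i) V * GVK b i q parS (parBY i) V ∧
      GVK b i q parS (parBY i) V = GK b i q parS (parBY i) + GVK b i q parS (parBY i) V * (VK b i q parS (parBY i) V * GK b i q parS (parBY i))) ∧
    ∀ (X : Module.End ℝ (FBondY i × ιb → ℝ)) (B₀' : ℝ) (P : BlkCubeY i q → ℝ), 0 ≤ B₀' → (∀ y, 0 ≤ P y) →
      HasMajorant (g := toB6 (geoCK i q) Rr H) (blkBK i q) (X * GK b i q parS (parBY i))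
        (fun a a' => B₀' * P a * Real.exp (-(ρ * (geoCK i q).dist a a'))) →
      HasMajorant (g := toB6 (geoCK i q) Rr H) (blkBK i q) (X * GVK b i q parS (parBY i) V)
        (fun a a' => B₀' * B6.c1 dB' ρ α' * (1 - kappa385d B₀ cV κ₁ κ₂ Λ (B6.c1 dB δ₀ β) (d + 1) * α₁ * B6.c1 dB' ρ α')⁻¹ * P a *
          Real.exp (-((1 - α') * ρ * (geoCK i q).dist a a'))) := by
  have h385 := h385_of_pieces b i q parS Rr H dB δ₀ δ α β ρ Λ B₀ cV κ₁ κ₂ α₁ hB₀ hcV hκ₁ hκ₂ hα₁ hΛ hρ hα hβ hδ₀ hr h261 hT1 hT2 V hG hDG hLap hV0 hV1 hPr hAv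
  have hθ : 0 ≤ kappa385d B₀ cV κ₁ κ₂ Λ (B6.c1 dB δ₀ β) (d + 1) * α₁ :=
    mul_nonneg (kappa385d_nonneg hB₀ hcV hκ₁ hκ₂ hΛ (B6RandomWalk.c1_nonneg _ _ _)) hα₁
  exact gStep_cube b i q parS (parBY i) hb₀ hparS (Node00.parBY_one i) Rr H dB' hθ hρ hα' hα'ρ h261' hsmall V h385

end Cube

end Literature.MathematicalPhysics.QuantumFieldTheory.Balaban1983to89.B9Cor35GAtCubeLetters

end
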